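import Summits.ResolutionOfSingularities.ResolutionOfSingularities.Theorems.NoPeriodicIsolatedAtom.Negative.FalseWithoutIsol

/-!
# `NoPeriodicIsolatedAtom` (crux stmt-ResolutionOfSingularities-16344, route `FrobeniusClosing`):
# the multiplicity hypothesis `MultP` is load-bearing — WITHOUT it the statement is FALSE
# (negative-side support, crux-disprover seat; this file does NOT refute the crux)

Companion of `FalseWithoutIsol` (refuter, landed): there the Whitney umbrella showed that `Isol`
cannot be dropped. Here we record, sorry-free, that `MultP` (cleaned order `≥ p`, non-zero) cannot
be dropped either, and WHY: the crux's `step` divides by `u_i ^ (if p ≤ ord (clean c) then p else 0)`,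
so at a state of cleaned order `< p` the division is by `u_i ^ 0 = 1` and — in dimension `n = 1`,
where the blow-up substitution and the translation are both the identity — the step is LITERALLY the
identity. The regular atom `z² = u` over `𝔽₂` (`p = 2`, `n = 1`, start `c₀ = u`, isolated: its
Jacobian ideal is `(∂u/∂u) = (1)`, quotient `0`) is therefore a fixed point of every step, and
`PairIso c₀ c₀` holds trivially (`φ = id`, `v = 1`, `g = 0`): the `MultP`-free version of the crux
fails at `(p, n, κ, r) = (2, 1, 𝔽₂, 1)`.

Reading for provers: every use the crux makes of "the chain never leaves multiplicity `p`" is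
genuinely needed — below multiplicity `p` the inlined dynamics is junk (no division), exactly as the
route text says ("divide z^p = a by u_i^p" is only meaningful at cleaned order `≥ p`). Together with
`FalseWithoutIsol` this exhausts the droppable hypotheses: the remaining binder `0 < r` is needed for
the even more trivial reason that `PairIso` is reflexive (`pairIso_refl`).

The dynamics is the crux's own `let`-block via the exact mirror of `FalseWithoutIsol`
(`clean bl ord dv tr step run ser pd jac`, certified by `crux_iff : NoPeriodicIsolatedAtom ↔ … :=
Iff.rfl` there); the refuted proposition is the right-hand side of `crux_iff` with the `MultP`
conjunct deleted and nothing else changed (stated inline; the witness is written out as a lambda — this file declares no definition under `Summits/`).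
-/

noncomputable section

-- single-problem summit: the doubled namespace component `ResolutionOfSingularities` is forced by the tree layout
set_option linter.dupNamespace false

namespace Summit.ResolutionOfSingularities.ResolutionOfSingularities.Theorems.NoPeriodicIsolatedAtom.Negative

open Summit.ResolutionOfSingularities.ResolutionOfSingularities.Theses.FrobeniusClosing (NoPeriodicIsolatedAtom)
open scoped BigOperators Classical

-- The regular start `u` over `𝔽₂` in dimension `n = 1` (the atom `z² = u`), as a coefficient
-- function, written out as the lambda `fun A => if A = ![1] then 1 else 0` throughout (proof-only file, no definition).

/-- `uline` is supported exactly on the exponent `1`. [folklore] -/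
lemma uline_ne_zero_iff (A : Fin 1 → ℕ) : (fun A : Fin 1 → ℕ => if A = ![1] then (1 : ZMod 2) else 0) A ≠ 0 ↔ A = ![1] := by
  by_cases h : A = ![1] <;> simp [h]

/-- `u` is `2`-clean (its exponent is odd). [folklore] -/
lemma clean_uline : clean 2 (fun A : Fin 1 → ℕ => if A = ![1] then (1 : ZMod 2) else 0) = (fun A : Fin 1 → ℕ => if A = ![1] then (1 : ZMod 2) else 0) := by
  funext A
  unfold clean
  by_cases h : ∀ j, 2 ∣ A j
  · rw [if_pos h]
    by_cases hA : A = ![1]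
    · exact absurd (h 0) (by simp [hA])
    · simp [hA]
  · rw [if_neg h]

/-- The order of `u` is `1`. [folklore] -/
lemma ord_uline : ord (fun A : Fin 1 → ℕ => if A = ![1] then (1 : ZMod 2) else 0) = 1 := by
  unfold ord
  have hset : {m : ℕ | ∃ A, (fun A : Fin 1 → ℕ => if A = ![1] then (1 : ZMod 2) else 0) A ≠ 0 ∧ m = Finset.sum Finset.univ (fun j => A j)} = {1} := by
    ext m
    simp only [Set.mem_setOf_eq, Set.mem_singleton_iff, uline_ne_zero_iff]
    constructor
    · rintro ⟨A, rfl, rfl⟩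
      simp
    · rintro rfl
      exact ⟨![1], rfl, by simp⟩
  rw [hset, csInf_singleton]

/-- In dimension `1` the blow-up substitution is the identity (there is no `u_j`, `j ≠ i`). [folklore] -/
lemma bl_one (c : (Fin 1 → ℕ) → ZMod 2) : bl 0 c = c := by
  funext B
  unfold bl
  have h0 : (Finset.univ.erase (0 : Fin 1)) = ∅ := by decide
  rw [h0, Finset.sum_empty, if_pos (Nat.zero_le _), Nat.sub_zero, Function.update_eq_self]

/-- Division by `u_i ^ 0` is the identity. [folklore] -/
lemma dv_zero_shift {n : ℕ} (i : Fin n) (c : (Fin n → ℕ) → ZMod 2) : dv i 0 c = c := by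
  funext B
  unfold dv
  rw [Nat.add_zero, Function.update_eq_self]

/-- In dimension `1` every translation is the identity (the translated variables are the `u_j`,
`j ≠ i`, and there are none). [folklore] -/
lemma tr_one (τ : Fin 1 → ZMod 2) (s : ℕ) (c : (Fin 1 → ℕ) → ZMod 2) : tr 0 τ s c = c := by
  funext B
  unfold tr
  have h0 : (Finset.univ.erase (0 : Fin 1)) = ∅ := by decide
  rw [Finset.sum_eq_single (0 : Fin 1 → ℕ)]
  · rw [if_pos (show (0 : Fin 1 → ℕ) 0 = 0 from rfl), h0, Finset.prod_empty, mul_one, add_zero]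
  · intro D _ hD
    have hD0 : D 0 ≠ 0 := by
      intro h
      apply hD
      funext j
      fin_cases j
      exact h
    rw [if_neg hD0]
  · intro h
    exact absurd (by simp [Fintype.mem_piFinset]) h

/-- **Fixed point**: at cleaned order `1 < p = 2` the step divides by `u ^ 0` and is the identity
on `u`, for every chart and every translation. [folklore] -/
lemma step_uline (τ : Fin 1 → ZMod 2) : step 2 0 τ (fun A : Fin 1 → ℕ => if A = ![1] then (1 : ZMod 2) else 0) = (fun A : Fin 1 → ℕ => if A = ![1] then (1 : ZMod 2) else 0) := by
  unfold step
  rw [clean_uline, ord_uline, if_neg (by norm_num : ¬ (2 ≤ 1)), bl_one, dv_zero_shift, tr_one,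
    clean_uline]

/-- Hence every run from `u` is constant. [folklore] -/
lemma run_uline (i : ℕ → Fin 1) (t : ℕ → Fin 1 → ZMod 2) (m : ℕ) : run 2 (fun A : Fin 1 → ℕ => if A = ![1] then (1 : ZMod 2) else 0) i t m = (fun A : Fin 1 → ℕ => if A = ![1] then (1 : ZMod 2) else 0) := by
  induction m with
  | zero => rfl
  | succ m ih =>
    show step 2 (i m) (t m) (run 2 (fun A : Fin 1 → ℕ => if A = ![1] then (1 : ZMod 2) else 0) i t m) = (fun A : Fin 1 → ℕ => if A = ![1] then (1 : ZMod 2) else 0)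
    rw [ih, Fin.fin_one_eq_zero (i m), step_uline]

/-- The Jacobian ideal of `u` is the unit ideal: `∂u/∂u = 1`. [folklore] -/
lemma jac_uline : jac 2 (fun A : Fin 1 → ℕ => if A = ![1] then (1 : ZMod 2) else 0) = ⊤ := by
  have hpd : pd 0 (ser 2 (fun A : Fin 1 → ℕ => if A = ![1] then (1 : ZMod 2) else 0)) = 1 := by
    refine MvPowerSeries.ext fun A => ?_
    rw [MvPowerSeries.coeff_one]
    change ((A 0 + 1 : ℕ) : ZMod 2) * clean 2 (fun A : Fin 1 → ℕ => if A = ![1] then (1 : ZMod 2) else 0) ((A + Finsupp.single (0 : Fin 1) 1 : Fin 1 →₀ ℕ) : Fin 1 → ℕ) = _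
    rw [clean_uline]
    beta_reduce
    have key : (((A + Finsupp.single (0 : Fin 1) 1 : Fin 1 →₀ ℕ) : Fin 1 → ℕ) = ![1]) ↔ A = 0 := by
      constructor
      · intro h
        have h0 := congrFun h 0
        simp at h0
        refine Finsupp.ext fun j => ?_
        fin_cases j
        simpa using h0
      · rintro rfl
        funext j
        fin_cases j
        simp
    by_cases hA : A = 0
    · rw [if_pos (key.mpr hA), if_pos hA, hA]
      simp
    · rw [if_neg (fun h => hA (key.mp h)), if_neg hA, mul_zero]
  unfold jac
  have hmem : (1 : MvPowerSeries (Fin 1) (ZMod 2)) ∈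
      Ideal.span (Set.range (fun i : Fin 1 => pd i (ser 2 (fun A : Fin 1 → ℕ => if A = ![1] then (1 : ZMod 2) else 0)))) :=
    Ideal.subset_span ⟨0, hpd⟩
  exact Ideal.eq_top_of_isUnit_mem _ hmem isUnit_one

/-- `u` is isolated (indeed regular): `κ[[u]] ⧸ (1) = 0` is a finite `κ`-module. [folklore] -/
lemma isol_uline : Module.Finite (ZMod 2) (MvPowerSeries (Fin 1) (ZMod 2) ⧸ jac 2 (fun A : Fin 1 → ℕ => if A = ![1] then (1 : ZMod 2) else 0)) := by
  rw [jac_uline]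
  haveI : Subsingleton (MvPowerSeries (Fin 1) (ZMod 2) ⧸ (⊤ : Ideal (MvPowerSeries (Fin 1) (ZMod 2)))) :=
    Ideal.Quotient.subsingleton_iff.mpr rfl
  exact Module.Finite.of_finite

/-- **`MultP` is load-bearing in `NoPeriodicIsolatedAtom`.** The proposition below is the
right-hand side of `crux_iff` with the multiplicity conjunct
`(∃ A, clean p (run …) A ≠ 0) ∧ ∀ A, clean p (run …) A ≠ 0 → p ≤ Σ_j A j` deleted and nothing
else changed; it is false: the regular atom `z² = u` over `𝔽₂` (`n = 1`) is isolated, has cleaned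
order `1 < 2`, so the crux's step divides by `u ^ 0` and fixes it, and `PairIso` is reflexive. Any
proof of the crux must use `MultP` (below multiplicity `p` the inlined dynamics is junk).
[cite: HauserPerlega2019, §2 (the transform z ↦ z/u_i is taken at order ≥ p only)] -/
theorem noPeriodicIsolatedAtom_false_without_MultP :
    ¬ ∀ p : ℕ, p.Prime → ∀ n : ℕ, 0 < n → ∀ (κ : Type) [Field κ] [Algebra (ZMod p) κ] [Algebra.IsAlgebraic (ZMod p) κ]
        (c₀ : (Fin n → ℕ) → κ) (i : ℕ → Fin n) (t : ℕ → Fin n → κ) (r : ℕ), 0 < r →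
        (∀ m, m ≤ r → Module.Finite κ (MvPowerSeries (Fin n) κ ⧸ jac p (run p c₀ i t m))) →
        ¬ ∃ (φ : MvPowerSeries (Fin n) κ ≃ₐ[κ] MvPowerSeries (Fin n) κ) (v g : MvPowerSeries (Fin n) κ),
            IsUnit v ∧ φ (ser p (run p c₀ i t 0)) = v ^ p * ser p (run p c₀ i t r) + g ^ p := by
  intro h
  have key := h 2 Nat.prime_two 1 one_pos (ZMod 2) (fun A : Fin 1 → ℕ => if A = ![1] then (1 : ZMod 2) else 0) (fun _ => 0) (fun _ _ => 0) 1 one_pos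
    (fun m _ => by rw [run_uline]; exact isol_uline)
  apply key
  rw [run_uline, run_uline]
  exact pairIso_refl 2 two_ne_zero (fun A : Fin 1 → ℕ => if A = ![1] then (1 : ZMod 2) else 0)

end Summit.ResolutionOfSingularities.ResolutionOfSingularities.Theorems.NoPeriodicIsolatedAtom.Negative

end
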